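import Literature.MathematicalPhysics.QuantumLattice.MagneticHubbardTorus
import HarnessLib

/-!
# The magnetic Hubbard torus with trivial field is the Hubbard torus (`L ≥ 3`)

Topic `Literature/MathematicalPhysics/QuantumLattice` (family `hubbard`); companion of
`MagneticHubbardTorus.lean`. Proved here: for `3 ≤ L` and all `t`, `U`,
`magneticHubbardTorus L 1 t U = hubbardTorus 2 L t U` (`magneticHubbardTorus_one_eq_hubbardTorus`).

The content is the bond/edge bookkeeping of the discrete torus `(ℤ/L)²`: the Hubbard hopping
term of `hamiltonian (fermionTorusGraph 2 L)` sums `c†_{uσ} c_{vσ}` over ORDERED adjacent pairs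
`u ∼ v` of the simple torus graph (`torusGraph 2 L`, adjacency `y = x ± eᵢ`), while the Peierls
form sums `c†_{x+eᵢ} c_x + c†_x c_{x+eᵢ}` over positively oriented EDGES `(x, i)`. For `L ≥ 3`
the four neighbours `x ± e₀, x ± e₁` are pairwise distinct (`sum_ite_torusGraph_two_adj`), so each
bond is exactly one oriented edge met in both orders (`sum_sum_ite_torusGraph_two_adj`); for `L = 2`
(`x + eᵢ = x − eᵢ`) the edge sum double counts and the identity fails, for `L = 1` both sides
vanish trivially but the lemma is not needed.

Related tree lemmas (not imported, to keep this file's import closure at `MagneticHubbardTorus`):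
`sum_ite_torusGraph_adj` of `HubbardFreePropagator` (general `d`, `ℂ`-valued summands) and
`sum_ite_torusGraph_adj'`, `sum_sum_ite_torusGraph_adj` of `XYZGroundStateOrderProofs` (general
`d`, symmetric kernels, `2 • Σ_x Σᵢ F x (x + eᵢ)`); here `d = 2`, the summands are operators, and
the ORIENTED form `Σ_{x,i} [F (x + eᵢ) x + F x (x + eᵢ)]` (no symmetry of `F`) is what the
Peierls term needs.

## References

* S. Friedli, Y. Velenik, *Statistical Mechanics of Lattice Systems* (2017), §3.1 (the torus
  graph). [FriedliVelenik2017]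
* E. H. Lieb, PRL 73 (1994) 2158, eq. (1) (hopping with phases; `φ ≡ 0`). [Lieb1994]
-/

noncomputable section

namespace Literature.MathematicalPhysics.QuantumLattice

open Matrix Finset Literature.MathematicalPhysics.QuantumFieldTheory
open scoped ComplexConjugate

variable {L : ℕ}

/-! ### The trivial field: `H_1 = hubbardTorus` for `L ≥ 3` -/

section TrivialField

/-- `(1 : ℤ/L) ≠ 0` for `L ≥ 2`. [folklore] -/
theorem zmod_one_ne_zero_of_two_le (hL : 2 ≤ L) : (1 : ZMod L) ≠ 0 := by
  haveI : Fact (1 < L) := ⟨by omega⟩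
  exact one_ne_zero

/-- `(1 : ℤ/L) + 1 ≠ 0` for `L ≥ 3`. [folklore] -/
theorem zmod_one_add_one_ne_zero_of_three_le (hL : 3 ≤ L) : (1 : ZMod L) + 1 ≠ 0 := by
  have h : ((2 : ℕ) : ZMod L) ≠ 0 := by
    rw [Ne, ZMod.natCast_eq_zero_iff]
    intro hd
    have := Nat.le_of_dvd (by norm_num) hd
    omega
  simpa [one_add_one_eq_two] using h

/-- The unit vectors `eᵢ = Pi.single i 1` of `(ℤ/L)²` are nonzero for `L ≥ 2`. [folklore] -/
theorem torusUnit_ne_zero (hL : 2 ≤ L) (i : Fin 2) : (Pi.single i 1 : Site 2 L) ≠ 0 := by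
  intro h
  have := congrFun h i
  simp only [Pi.single_eq_same, Pi.zero_apply] at this
  exact zmod_one_ne_zero_of_two_le hL this

/-- `e₀ ≠ e₁` in `(ℤ/L)²` for `L ≥ 2`. [folklore] -/
theorem torusUnit_zero_ne_one (hL : 2 ≤ L) :
    (Pi.single 0 1 : Site 2 L) ≠ Pi.single 1 1 := by
  intro h
  have := congrFun h 0
  simp only [Pi.single_eq_same, ne_eq, zero_ne_one, not_false_eq_true,
    Pi.single_eq_of_ne] at this
  exact zmod_one_ne_zero_of_two_le hL this

/-- `eᵢ + eⱼ ≠ 0` in `(ℤ/L)²` for `L ≥ 3` (for `i = j` this is `2 ≠ 0`, which fails at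
`L = 2`). [folklore] -/
theorem torusUnit_add_torusUnit_ne_zero (hL : 3 ≤ L) (i j : Fin 2) :
    (Pi.single i 1 : Site 2 L) + Pi.single j 1 ≠ 0 := by
  intro h
  have hi := congrFun h i
  simp only [Pi.add_apply, Pi.single_eq_same, Pi.zero_apply] at hi
  by_cases hij : j = i
  · subst hij
    simp only [Pi.single_eq_same] at hi
    exact zmod_one_add_one_ne_zero_of_three_le hL hi
  · rw [Pi.single_eq_of_ne (Ne.symm hij) , add_zero] at hi
    exact zmod_one_ne_zero_of_two_le (by omega) hi

/-- Adjacency on the torus `(ℤ/L)²`, `L ≥ 2`: `x ∼ y` iff `y = x ± eᵢ` for some `i` (the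
condition `x ≠ y` of `torusGraph` is automatic). Friedli–Velenik (2017) §3.1. [folklore] -/
theorem torusGraph_two_adj_iff (hL : 2 ≤ L) (x y : Site 2 L) :
    (Literature.Probability.LatticeModels.torusGraph 2 L).Adj x y ↔
      (∃ i, y = x + Pi.single i 1) ∨ ∃ i, y = x - Pi.single i 1 := by
  rw [Literature.Probability.LatticeModels.torusGraph_adj_iff]
  constructor
  · rintro ⟨-, h | ⟨i, h⟩⟩
    · exact Or.inl h
    · exact Or.inr ⟨i, by rw [h, add_sub_cancel_right]⟩
  · rintro (⟨i, h⟩ | ⟨i, h⟩)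
    · refine ⟨?_, Or.inl ⟨i, h⟩⟩
      rw [h]
      intro hx
      exact torusUnit_ne_zero hL i (by simpa using hx.symm)
    · refine ⟨?_, Or.inr ⟨i, by rw [h, sub_add_cancel]⟩⟩
      rw [h]
      intro hx
      exact torusUnit_ne_zero hL i (by simpa [sub_eq_add_neg] using hx)

/-- **Neighbour sum on `(ℤ/L)²`, `L ≥ 3`.** The sum over the neighbours `y ∼ x` of the simple
torus graph is the sum over the four *distinct* sites `x ± eᵢ`: `Σ_{y ∼ x} g y =
Σᵢ g (x + eᵢ) + Σᵢ g (x − eᵢ)`. (False for `L = 2`, where `x + eᵢ = x − eᵢ`.) [folklore] -/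
theorem sum_ite_torusGraph_two_adj {M : Type*} [AddCommMonoid M] [NeZero L] (hL : 3 ≤ L)
    (x : Site 2 L) (g : Site 2 L → M) :
    (∑ y : Site 2 L,
        if (Literature.Probability.LatticeModels.torusGraph 2 L).Adj x y then g y else 0) =
      ∑ i, g (x + Pi.single i 1) + ∑ i, g (x - Pi.single i 1) := by
  have hL2 : 2 ≤ L := by omega
  -- the four neighbours `x ± eᵢ` are pairwise distinct
  have hne : ∀ {a b : Site 2 L}, a ≠ b → x + a ≠ x + b := fun h h' => h (add_left_cancel h')
  have hns : ∀ {a b : Site 2 L}, a + b ≠ 0 → x + a ≠ x - b := fun h h' =>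
    h (eq_neg_iff_add_eq_zero.mp (add_left_cancel (h'.trans (sub_eq_add_neg x _))))
  have hss : ∀ {a b : Site 2 L}, a ≠ b → x - a ≠ x - b := fun h h' => h (sub_right_inj.mp h')
  have h12 := hne (torusUnit_zero_ne_one hL2)
  have h13 := hns (torusUnit_add_torusUnit_ne_zero hL 0 0)
  have h14 := hns (torusUnit_add_torusUnit_ne_zero hL 0 1)
  have h23 := hns (torusUnit_add_torusUnit_ne_zero hL 1 0)
  have h24 := hns (torusUnit_add_torusUnit_ne_zero hL 1 1)
  have h34 := hss (torusUnit_zero_ne_one hL2)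
  have key : ∀ y : Site 2 L,
      (if (Literature.Probability.LatticeModels.torusGraph 2 L).Adj x y then g y else 0) =
        (∑ i, if y = x + Pi.single i 1 then g y else 0) +
          ∑ i, if y = x - Pi.single i 1 then g y else 0 := by
    intro y
    simp only [torusGraph_two_adj_iff hL2, Fin.exists_fin_two, Fin.sum_univ_two]
    by_cases ha : y = x + Pi.single 0 1
    · subst ha
      simp only [h12, h13, h14, or_false, reduceIte, add_zero]
    by_cases hb : y = x + Pi.single 1 1
    · subst hb
      simp only [h12.symm, h23, h24, or_false, or_true, reduceIte, add_zero, zero_add]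
    by_cases hc : y = x - Pi.single 0 1
    · subst hc
      simp only [h13.symm, h23.symm, h34, or_false, or_true, reduceIte, add_zero, zero_add]
    by_cases hd : y = x - Pi.single 1 1
    · subst hd
      simp only [h14.symm, h24.symm, h34.symm, or_true, reduceIte, zero_add]
    simp only [ha, hb, hc, hd, or_self, reduceIte, add_zero]
  simp_rw [key, Finset.sum_add_distrib]
  congr 1
  · rw [Finset.sum_comm]
    simp
  · rw [Finset.sum_comm]
    simp

/-- **Ordered nearest-neighbour pairs of `(ℤ/L)²`, `L ≥ 3`, are the oriented edges.** For any
`F`, `Σ_{x ∼ y} F x y = Σ_{x, i} [F (x + eᵢ) x + F x (x + eᵢ)]`: each bond of the simple torus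
graph is exactly one positively oriented edge `(x, x + eᵢ)`, met in both orders. [folklore] -/
theorem sum_sum_ite_torusGraph_two_adj {M : Type*} [AddCommMonoid M] [NeZero L] (hL : 3 ≤ L)
    (F : Site 2 L → Site 2 L → M) :
    (∑ x : Site 2 L, ∑ y : Site 2 L,
        if (Literature.Probability.LatticeModels.torusGraph 2 L).Adj x y then F x y else 0) =
      ∑ x : Site 2 L, ∑ i : Fin 2, (F (x + Pi.single i 1) x + F x (x + Pi.single i 1)) := by
  have hre : ∀ i : Fin 2, ∑ x : Site 2 L, F x (x - Pi.single i 1) =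
      ∑ x : Site 2 L, F (x + Pi.single i 1) x := fun i =>
    Fintype.sum_equiv (Equiv.subRight (Pi.single i (1 : ZMod L) : Site 2 L)) _ _ fun x => by
      simp only [Equiv.subRight_apply, sub_add_cancel]
  calc (∑ x : Site 2 L, ∑ y : Site 2 L,
        if (Literature.Probability.LatticeModels.torusGraph 2 L).Adj x y then F x y else 0)
      = ∑ x : Site 2 L, ((∑ i, F x (x + Pi.single i 1)) + ∑ i, F x (x - Pi.single i 1)) :=
        Finset.sum_congr rfl fun x _ => sum_ite_torusGraph_two_adj hL x (F x)
    _ = (∑ x : Site 2 L, ∑ i, F x (x + Pi.single i 1)) +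
          ∑ x : Site 2 L, ∑ i, F x (x - Pi.single i 1) := Finset.sum_add_distrib
    _ = (∑ x : Site 2 L, ∑ i, F x (x + Pi.single i 1)) +
          ∑ x : Site 2 L, ∑ i, F (x + Pi.single i 1) x := by
        congr 1
        rw [Finset.sum_comm]
        simp only [hre]
        exact Finset.sum_comm
    _ = ∑ x : Site 2 L, ∑ i : Fin 2, (F (x + Pi.single i 1) x + F x (x + Pi.single i 1)) := by
        rw [add_comm, ← Finset.sum_add_distrib]
        exact Finset.sum_congr rfl fun x _ => Finset.sum_add_distrib.symm

variable [NeZero L]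

/-- The Hubbard hopping term of the fermionic torus, transported to `(ℤ/L)²`-indexed sums:
`Σ_{u ∼ v, σ} c†_{uσ} c_{vσ} = Σ_{x ∼ y} Σ_σ c†_{xσ} c_{yσ}` along `FermionTorus.ofTorusSite`.
[folklore] -/
theorem sum_fermionTorusGraph_adj_eq_sum_torusGraph_adj :
    (∑ u : FermionTorus 2 L, ∑ v : FermionTorus 2 L, ∑ σ : Fin 2,
        if (fermionTorusGraph 2 L).Adj u v then
          (creation (orb u σ) * annihilation (orb v σ) :
            Matrix (Finset (Orb (FermionTorus 2 L))) (Finset (Orb (FermionTorus 2 L))) ℂ)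
        else 0) =
      ∑ x : Site 2 L, ∑ y : Site 2 L,
        if (Literature.Probability.LatticeModels.torusGraph 2 L).Adj x y then
          ∑ σ : Fin 2, (creation (orb (FermionTorus.ofTorusSite x) σ) *
            annihilation (orb (FermionTorus.ofTorusSite y) σ) :
              Matrix (Finset (Orb (FermionTorus 2 L))) (Finset (Orb (FermionTorus 2 L))) ℂ)
        else 0 := by
  refine Fintype.sum_equiv FermionTorus.equivTorusSite _ _ fun u => ?_
  refine Fintype.sum_equiv FermionTorus.equivTorusSite _ _ fun v => ?_
  rw [Finset.sum_ite_irrel, Finset.sum_const_zero]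
  simp only [FermionTorus.equivTorusSite, Equiv.coe_fn_mk, fermionTorusGraph_adj,
    FermionTorus.ofTorusSite_toTorusSite]

/-- **Trivial field.** With all Peierls phases equal to `1` and `L ≥ 3` the magnetic Hubbard
torus is the Hubbard torus `hubbardTorus 2 L t U`: every nearest-neighbour bond `{x, x + eᵢ}` of
`(ℤ/L)²` is exactly one positively oriented edge and contributes `c†_{x+eᵢ} c_x + c†_x c_{x+eᵢ}`.
(For `L = 2` the right-hand side counts each bond once but the edge sum twice.)
Lieb, PRL 73 (1994) 2158, eq. (1) with `φ ≡ 0`. [folklore] -/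
theorem magneticHubbardTorus_one_eq_hubbardTorus (hL : 3 ≤ L) (t U : ℝ) :
    magneticHubbardTorus L 1 t U = hubbardTorus 2 L t U := by
  have h := sum_sum_ite_torusGraph_two_adj hL fun x y : Site 2 L =>
    ∑ σ : Fin 2, (creation (orb (FermionTorus.ofTorusSite x) σ) *
      annihilation (orb (FermionTorus.ofTorusSite y) σ) :
        Matrix (Finset (Orb (FermionTorus 2 L))) (Finset (Orb (FermionTorus 2 L))) ℂ)
  simp only [magneticHubbardTorus, hubbardTorus, hamiltonian, Pi.one_apply, Circle.coe_one,
    map_one, one_smul]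
  rw [sum_fermionTorusGraph_adj_eq_sum_torusGraph_adj, h]
  simp only [Site.shift, Finset.sum_add_distrib]

end TrivialField

end Literature.MathematicalPhysics.QuantumLattice
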